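import Literature.AlgebraicGeometry.Resolution.ExceptionalDivisorProjectiveBundleAffine
import HarnessLib

/-!
# [OURS · L1 W4.5(b) · EL♮(3) · (T-C) TANGENT-CONE DOOR, part 1] THE STRICT TRANSFORM MEETS THE EXCEPTIONAL FIBRE INSIDE THE
# PROJECTIVISED TANGENT CONE — chart algebra and the affine form

Cell `res-hironaka`, LADDER-RESOLUTION rung L (D-0089), slot W4.5(b), crux chain w45b: child crux **EL♮(3)** = stmt-ResolutionOfSingularities-20148.
WIDTH seat res-L1-w45b-iso-w4 g2 (D-0157 DOOR 1); desk booking «(T-C) TANGENT-CONE DOOR» (res-L1-w45b-plan-1 g23, STATUS 2026-08-28T20:15:45Z):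
the one generic piece between the NEST-clause door (res-L1-w45b-iso-w2 ✓ `dirStepUnobs_freshPlane_of_forall_model`, ✓ `dirStepUnobs_freshPlane_of_one_model`)
and the MODEL certificates (✓ `S10Conic.dirStepUnobs_conic_linearChange`, ✓ `ProjLin.dirStepUnobs_line`, ✓ `PlaneCurveSplit.dirStepUnobs_planeCurve`):
a fresh-plane isomorphism `ℙⁿ ≅ Ẽ_x` that is AWARE OF COORDINATES, i.e. under which the strict transform of a hypersurface `V(f) ∋ x` meets the
fresh plane inside the projectivised tangent cone `V₊(in f)`.  `--supports stmt-ResolutionOfSingularities-20148 --as helper`.  OURS; NOT a statement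
of H. Hironaka's 2017 manuscript (nothing of [Hironaka2017] is asserted); AI-written, and AI review is weaker than expert review.  DEF-FREE; no `sorry`;
standard axioms.  EL♮(3) is NOT proved here; resolution of singularities in positive characteristic is NOT proved here (dimension 3 is Cossart–Piltant
2008/2009 in print); counted 0 toward the summit.

THIS FILE (part 1): the chart computation and the AFFINE form, in the setting of the Literature's Hartshorne II 8.24 (b)
✓ `Literature.AlgebraicGeometry.Resolution.exists_iso_pullback_proj_charts` (`M` affine, `i₀ : B ↪ M` closed with `(ker i₀)(M) = (x₀,…,xₙ)`,
`x` quasi-regular, `β : X' → M` a blowing up along `ker i₀`, `E := X' ×_M B ≅ ℙⁿ_{Γ(B)}` with pinned chart maps `ψ_j`):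
* `eval₂_const_mul` — Euler scaling `P(c·T) = cᵐ P(T)` for a form of degree `m` (the tree's `ProjectiveSpace.isHomogeneous_aeval_const_mul`, `eval₂` form);
* `exists_chart_factorisation` — pure algebra of the chart `X'[x_j]`: if every `x_l ↦ x_j · T_l` and `f ≡ P(x) mod (x)^{m+1}` with `P` a form of
  degree `m`, then `f ↦ x_jᵐ · (P(T) + x_j · r)`: the strict transform `f_j = P(T) + x_j r` of `f` on the chart reduces to the initial form on `x_j = 0`;
* `isLocalizationElem_eq_eval₂_frac` — in `(R[T]_{T_j})₀`, `F/T_jᵐ = F(T₀/T_j, …, Tₙ/T_j)` for a form `F` of degree `m`;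
* `fst_app_appLE_eq_zero` — sections of the centre ideal vanish on `E`; `chartMap_isLocalizationElem_eq` — `ψ_j(P̄/T_jᵐ) = (P^{β^*}(T_{j·}))|_E`;
* `not_mem_basicOpen_of_mem_closure` — POINTS: if `f` vanishes on `T' ⊆ M`, no point of the closure of `β⁻¹(T' ∖ V(ker i₀))` lies in `D(f_j)`;
* ★ `mem_zeroLocus_of_mem_closure_strictTransform` — **(T-C), AFFINE FORM**: for the isomorphism `φ : E ≅ ℙⁿ_{Γ(B)}` of loc. cit., every point of
  `E` lying (in `X'`) in the closure of `β⁻¹(T' ∖ V(ker i₀))` is mapped into `V₊(P̄)`, `P̄ = P^{i₀^*} ∈ Γ(B)[T₀,…,Tₙ]` the reduced initial form.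
Part 2 (`…NatTangentConeDoor`) transports this to the chain's fresh plane `redSub G' (υ⁻¹{x})` of a point step.

HONEST SCOPE.  Set-level `⊆` only: no equality `= V₊(P̄)` (that needs `P̄ ≠ 0` plus a dimension count on the strict transform) and no scheme structure
on the strict transform is asserted; `P̄ = 0` (e.g. `f ∈ (x)^{m+1}`) makes the conclusion vacuous; `m = 0` is excluded (`0 < m` is used to read `D₊(P̄)`
on the charts); for `m = 1` (`f` a member of a regular system of parameters modulo `(x)²`, `P` a linear form) the statement says the strict transform meets
the exceptional fibre inside the HYPERPLANE `V₊(P̄)` — the set-level shadow of the scheme-level (F⁺5) ✓ `comap_strictTransformIdeal_eq_of_model`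
(res-D-pv-027, `…NatStrictTransformComap`), which we cite and do not restate; `n = 0`: `ℙ⁰` is a point and `V₊(P̄)` is empty or everything, consistent.
The initial form is USER-SUPPLIED as a form `P` over `Γ(M)` with `f − P(x) ∈ (x)^{m+1}` (no associated-graded ring is built).

References (index only): R. Hartshorne, *Algebraic Geometry* (1977), II Thm. 8.24 (b), II §7 (blowing up; strict transform, proof of 7.15 / Ex. 7.12),
I Thm. 3.4 (dehomogenisation) [cite: Hartshorne1977]; V. Cossart, O. Piltant, J. Algebra 320 (2008), proof of Prop. 4.2, (10)–(11) (the chart congruence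
`y₁^{-μ} f ≡ F(1, y₂', y₃') mod (y₁')`) [cite: CossartPiltant2008]; The Stacks Project, Tag 0804 (affine blow-up charts) [cite: StacksProject].
-/

set_option linter.dupNamespace false

noncomputable section

set_option backward.isDefEq.respectTransparency false

open CategoryTheory CategoryTheory.Limits AlgebraicGeometry TopologicalSpace Opposite MvPolynomial
open HomogeneousLocalization
open Literature.AlgebraicGeometry.Motives Literature.AlgebraicGeometry.Motives.Segre
open Literature.AlgebraicGeometry.Resolution

attribute [local instance] MvPolynomial.gradedAlgebra ProjBaseChange.algebraBase

namespace Summit.ResolutionOfSingularities.ResolutionOfSingularities.Cruxes.EquisingularLiftNat.Sections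

namespace TangentCone

universe u

/-! ### (A) Pure algebra -/

/-- **Euler scaling for `eval₂`**: for `P` homogeneous of degree `m`, `P(c·T) = cᵐ · P(T)` under any coefficient map. [folklore] -/
theorem eval₂_const_mul {A S : Type*} [CommRing A] [CommRing S] (pb : A →+* S) {ι : Type*} {m : ℕ}
    {P : MvPolynomial ι A} (hP : P.IsHomogeneous m) (c : S) (T : ι → S) :
    eval₂ pb (fun l => c * T l) P = c ^ m * eval₂ pb T P := by
  letI := pb.toAlgebra
  have h1 : eval₂ pb (fun l => c * T l) P = aeval (fun l => c * T l) P := rfl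
  have h2 : eval₂ pb T P = aeval T P := rfl
  rw [h1, h2]
  exact ProjectiveSpace.isHomogeneous_aeval_const_mul hP c T

/-- **Chart factorisation of an equation with a given initial form.** If `pb : A → S` is a ring map under which every `t_l` becomes a
multiple `pb t_j · T_l` of `pb t_j` (the blow-up chart `X'[t_j]`), `P ∈ A[T₀,…,Tₙ]` is homogeneous of degree `m` and
`f ≡ P(t) mod (t)^{m+1}`, then `pb f = (pb t_j)ᵐ · (P^{pb}(T) + pb t_j · r)` for some `r`: the strict transform of `f` on the chart is
`f_j = P^{pb}(T) + pb t_j · r`, congruent to the initial form evaluated at the ratios modulo the exceptional equation. [folklore]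
[cite: CossartPiltant2008, proof of Prop. 4.2, (10)–(11)] -/
theorem exists_chart_factorisation {A S : Type*} [CommRing A] [CommRing S] (pb : A →+* S) {n : ℕ}
    (t : Fin (n + 1) → A) (j : Fin (n + 1)) (T : Fin (n + 1) → S) (hT : ∀ l, pb (t l) = pb (t j) * T l)
    {m : ℕ} {P : MvPolynomial (Fin (n + 1)) A} (hP : P.IsHomogeneous m) {f : A}
    (hf : f - MvPolynomial.eval t P ∈ Ideal.span (Set.range t) ^ (m + 1)) :
    ∃ r : S, pb f = pb (t j) ^ m * (eval₂ pb T P + pb (t j) * r) := by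
  -- the image of `(t)` lies in `(pb t_j)`
  have hmap : Ideal.map pb (Ideal.span (Set.range t)) ≤ Ideal.span {pb (t j)} := by
    rw [Ideal.map_span]
    refine Ideal.span_le.2 ?_
    rintro _ ⟨_, ⟨l, rfl⟩, rfl⟩
    exact Ideal.mem_span_singleton'.2 ⟨T l, by rw [hT l, mul_comm]⟩
  have hr : pb (f - MvPolynomial.eval t P) ∈ Ideal.span {pb (t j) ^ (m + 1)} := by
    have h1 : pb (f - MvPolynomial.eval t P) ∈ Ideal.map pb (Ideal.span (Set.range t) ^ (m + 1)) :=
      Ideal.mem_map_of_mem _ hf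
    rw [Ideal.map_pow] at h1
    rw [← Ideal.span_singleton_pow]
    exact Ideal.pow_right_mono hmap _ h1
  obtain ⟨r, hr⟩ := Ideal.mem_span_singleton'.1 hr
  -- `pb (P(t)) = (pb t_j)^m · P^{pb}(T)`
  have hP' : pb (MvPolynomial.eval t P) = pb (t j) ^ m * eval₂ pb T P := by
    rw [MvPolynomial.eval_eq, show (∑ d ∈ P.support, P.coeff d * ∏ i ∈ d.support, t i ^ d i) = eval₂ (RingHom.id A) t P from
      (MvPolynomial.eval₂_eq (RingHom.id A) t P).symm, eval₂_comp_left pb (RingHom.id A) t P, RingHom.comp_id]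
    have : (⇑pb ∘ t) = fun l => pb (t j) * T l := funext fun l => hT l
    rw [this, eval₂_const_mul pb hP]
  refine ⟨r, ?_⟩
  have e : pb f = pb (MvPolynomial.eval t P) + pb (f - MvPolynomial.eval t P) := by rw [map_sub]; ring
  rw [e, hP', ← hr]
  ring

/-- **Dehomogenisation of a form as a polynomial in the ratios**: for `F ∈ R[T₀,…,Tₙ]` homogeneous of degree `m`, the degree-zero fraction
`F / T_jᵐ ∈ (R[T]_{T_j})₀` equals `F` evaluated at the ratios `T_l/T_j` with constant coefficients (Euler's identity with `c = 1/T_j`).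
[cite: Hartshorne1977, I Thm. 3.4 (proof)] -/
theorem isLocalizationElem_eq_eval₂_frac (R : Type u) [CommRing R] {n : ℕ} (j : Fin (n + 1)) {m : ℕ}
    {F : MvPolynomial (Fin (n + 1)) R} (hF : F ∈ grading (Fin (n + 1)) R m) :
    Away.isLocalizationElem (X_mem R j) hF = eval₂ (cst R (X j)) (frac R j) F := by
  refine HomogeneousLocalization.val_injective _ ?_
  have hval : (eval₂ (cst R (X j)) (frac R j) F).val =
      eval₂ ((algebraMap (Away (grading (Fin (n + 1)) R) (X j)) (Localization.Away (X j : MvPolynomial (Fin (n + 1)) R))).comp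
        (cst R (X j))) (fun l => (frac R j l).val) F := by
    rw [← HomogeneousLocalization.algebraMap_apply, eval₂_comp_left]
    rfl
  rw [hval]
  have hc : ((algebraMap (Away (grading (Fin (n + 1)) R) (X j)) (Localization.Away (X j : MvPolynomial (Fin (n + 1)) R))).comp
      (cst R (X j))) = (algebraMap (MvPolynomial (Fin (n + 1)) R) (Localization.Away (X j : MvPolynomial (Fin (n + 1)) R))).comp C := by
    ext c : 1
    simp only [RingHom.coe_comp, Function.comp_apply, HomogeneousLocalization.algebraMap_apply, val_cst]
  have hfr : (fun l => (frac R j l).val) = fun l => Localization.mk 1 (⟨X j ^ 1, 1, rfl⟩ : Submonoid.powers (X j : MvPolynomial (Fin (n + 1)) R)) *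
      algebraMap (MvPolynomial (Fin (n + 1)) R) (Localization.Away (X j : MvPolynomial (Fin (n + 1)) R)) (X l) := by
    funext l
    rw [val_frac, ← Localization.mk_one_eq_algebraMap, Localization.mk_mul, one_mul, mul_one, pow_one]
  have hFh : F.IsHomogeneous m := by simpa using hF
  rw [hc, hfr, eval₂_const_mul _ hFh]
  have h2 : eval₂ ((algebraMap (MvPolynomial (Fin (n + 1)) R) (Localization.Away (X j : MvPolynomial (Fin (n + 1)) R))).comp C)
      (fun l => algebraMap (MvPolynomial (Fin (n + 1)) R) (Localization.Away (X j : MvPolynomial (Fin (n + 1)) R)) (X l)) F =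
      algebraMap (MvPolynomial (Fin (n + 1)) R) (Localization.Away (X j : MvPolynomial (Fin (n + 1)) R)) F := by
    rw [show (fun l => algebraMap (MvPolynomial (Fin (n + 1)) R) (Localization.Away (X j : MvPolynomial (Fin (n + 1)) R)) (X l)) =
      ⇑(algebraMap (MvPolynomial (Fin (n + 1)) R) (Localization.Away (X j : MvPolynomial (Fin (n + 1)) R))) ∘ X from rfl,
      ← eval₂_comp_left, show eval₂ C X F = F from MvPolynomial.eval₂_eta F]
  rw [h2, Away.val_mk, Localization.mk_pow, ← Localization.mk_one_eq_algebraMap, Localization.mk_mul, pow_one, one_pow, one_mul, mul_one]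
  exact Localization.mk_eq_mk_iff.mpr (Localization.r_of_eq (by simp))

/-! ### (B) Sections on the scheme-theoretic fibre `E = X' ×_M B` of a blow-up chart

Setting of Literature `exists_iso_pullback_proj_charts` (ExceptionalDivisorProjectiveBundleAffine): `M` affine, `i₀ : B ↪ M` a closed immersion,
`β : X' → M`; `X'[⊤, u]` the principal chart, `pb_u a := β^* a |_{X'[⊤,u]}`. -/

section Fibre

variable {X' M B : Scheme.{u}} [IsAffine M] {β : X' ⟶ M} {i₀ : B ⟶ M} [IsClosedImmersion i₀]

/-- **Sections of the centre ideal die on the fibre**: for `a ∈ (ker i₀)(M)` and any open `U ⊆ X'`, the pull-back `β^*a|_U` restricts to `0` on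
`E = X' ×_M B` (because `pr₁ ≫ β = pr₂ ≫ i₀` and `i₀^* a = 0`). [folklore] -/
theorem fst_app_appLE_eq_zero (U : X'.Opens) (hU : U ≤ β ⁻¹ᵁ ((⟨⊤, isAffineOpen_top M⟩ : M.affineOpens) : M.Opens))
    {a : Γ(M, ⊤)} (ha : a ∈ i₀.ker.ideal ⟨⊤, isAffineOpen_top M⟩) :
    (pullback.fst β i₀).app U (β.appLE ⊤ U hU a) = 0 := by
  have hker : i₀.appTop a = 0 := by
    have h := ha
    rw [Scheme.Hom.ker_apply i₀ ⟨⊤, isAffineOpen_top M⟩] at h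
    exact h
  have h2 : (pullback.fst β i₀).app U (β.appLE ⊤ U hU a) = (pullback.fst β i₀ ≫ β).appLE ⊤ (pullback.fst β i₀ ⁻¹ᵁ U) le_top a := by
    rw [Scheme.Hom.app_eq_appLE, ← CommRingCat.comp_apply, Scheme.Hom.appLE_comp_appLE]
  have hle : (⊤ : B.Opens) ≤ i₀ ⁻¹ᵁ (⊤ : M.Opens) := by rw [Scheme.Hom.preimage_top]
  rw [h2, appLE_congr_hom pullback.condition]
  have h4 : (pullback.snd β i₀ ≫ i₀).appLE ⊤ (pullback.fst β i₀ ⁻¹ᵁ U) ((pullback.condition (f := β) (g := i₀)) ▸ le_top) =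
      i₀.appLE ⊤ ⊤ hle ≫ (pullback.snd β i₀).appLE ⊤ (pullback.fst β i₀ ⁻¹ᵁ U) (by rw [Scheme.Hom.preimage_top]; exact le_top) :=
    (Scheme.Hom.appLE_comp_appLE _ _ _ _ _ _ _).symm
  rw [h4, CommRingCat.comp_apply]
  have h3 : i₀.appLE ⊤ ⊤ hle a = 0 := by
    rw [Scheme.Hom.appLE, CommRingCat.comp_apply]
    change B.presheaf.map _ (i₀.appTop a) = 0
    rw [hker, map_zero]
  rw [h3, map_zero]

omit [IsClosedImmersion i₀] in
/-- **The initial form on the fibre chart.** Let `x_l ∈ Γ(M)` with `β^*x_l = β^*x_j · T_{jl}` on `X'[⊤, x_j]`, and `ψ : (Γ(B)[T]_{T_j})₀ → Γ(E, E_j)`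
a ring map with `ψ(T_l/T_j) = pr₁^* T_{jl}` and `ψ(i₀^*a) = pr₁^*(β^*a)` (the chart map of `exists_iso_pullback_proj_charts`). Then for
`P ∈ Γ(M)[T₀,…,Tₙ]` homogeneous of degree `m`, with reduction `P̄ = P^{i₀^*} ∈ Γ(B)[T]`: `ψ(P̄ / T_jᵐ) = pr₁^*(P^{β^*}(T_{j·}))`. [folklore] -/
theorem chartMap_isLocalizationElem_eq {n : ℕ} (x : Fin (n + 1) → Γ(M, ⊤)) (j : Fin (n + 1))
    (T : Fin (n + 1) → Γ(X', blowupChart β i₀.ker ⟨⊤, isAffineOpen_top M⟩ (x j)))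
    (ψ : Away (grading (Fin (n + 1)) Γ(B, ⊤)) (MvPolynomial.X j) →+*
      Γ(pullback β i₀, pullback.fst β i₀ ⁻¹ᵁ blowupChart β i₀.ker ⟨⊤, isAffineOpen_top M⟩ (x j)))
    (hψT : ∀ l, ψ (frac (Γ(B, ⊤) : Type u) j l) =
      (pullback.fst β i₀).app (blowupChart β i₀.ker ⟨⊤, isAffineOpen_top M⟩ (x j)) (T l))
    (hψc : ∀ a : Γ(M, ⊤), ψ (cst (Γ(B, ⊤) : Type u) (MvPolynomial.X j) (i₀.appTop a)) =
      (pullback.fst β i₀).app (blowupChart β i₀.ker ⟨⊤, isAffineOpen_top M⟩ (x j))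
        (β.appLE ((⟨⊤, isAffineOpen_top M⟩ : M.affineOpens) : M.Opens) (blowupChart β i₀.ker ⟨⊤, isAffineOpen_top M⟩ (x j))
          (blowupChart_le_preimage β i₀.ker ⟨⊤, isAffineOpen_top M⟩ (x j)) a))
    {m : ℕ} {P : MvPolynomial (Fin (n + 1)) Γ(M, ⊤)} (hP : P.IsHomogeneous m) :
    ψ (Away.isLocalizationElem (X_mem (Γ(B, ⊤) : Type u) j)
        (by simpa using hP.map i₀.appTop.hom : MvPolynomial.map i₀.appTop.hom P ∈ grading (Fin (n + 1)) Γ(B, ⊤) m)) =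
      (pullback.fst β i₀).app (blowupChart β i₀.ker ⟨⊤, isAffineOpen_top M⟩ (x j))
        (eval₂ (β.appLE ((⟨⊤, isAffineOpen_top M⟩ : M.affineOpens) : M.Opens) (blowupChart β i₀.ker ⟨⊤, isAffineOpen_top M⟩ (x j))
          (blowupChart_le_preimage β i₀.ker ⟨⊤, isAffineOpen_top M⟩ (x j))).hom T P) := by
  rw [isLocalizationElem_eq_eval₂_frac, eval₂_map, eval₂_comp_left ψ, eval₂_comp_left]
  congr 1
  · ext a : 1
    simp only [RingHom.coe_comp, Function.comp_apply]
    exact hψc a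
  · funext l
    exact hψT l

omit [IsClosedImmersion i₀] in
/-- **The strict transform misses its chart equation off the exceptional locus, hence on the closure.** On the chart `X'[⊤, x_j]` of a blow-up
`β` of `M` along `ker i₀ = (x₀,…,xₙ)`, let `β^*f = (β^*x_j)ᵐ · f_j` (`m > 0`) and let `T' ⊆ M` be a set on which `f` vanishes. Then no point of the
closure of `β⁻¹(T' ∖ V(ker i₀))` lies in `D(f_j)`: at a point `w ∈ D(f_j)` over `T' ∖ V(ker i₀)` some generator `x_l`, hence `β^*x_j`, is invertible,
so `β^*f` would be invertible at `w`, i.e. `f(β w) ≠ 0`. [folklore] [cite: Hartshorne1977, II Ex. 7.12 / proof of II 7.15 (strict transform)] -/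
theorem not_mem_basicOpen_of_mem_closure (hβ : IsBlowup β i₀.ker) {n : ℕ} (x : Fin (n + 1) → Γ(M, ⊤))
    (hgen : Ideal.span (Set.range x) = i₀.ker.ideal ⟨⊤, isAffineOpen_top M⟩) (j : Fin (n + 1))
    (f : Γ(M, ⊤)) {m : ℕ} (hm : 0 < m) (fj : Γ(X', blowupChart β i₀.ker ⟨⊤, isAffineOpen_top M⟩ (x j)))
    (hfj : β.appLE ((⟨⊤, isAffineOpen_top M⟩ : M.affineOpens) : M.Opens) (blowupChart β i₀.ker ⟨⊤, isAffineOpen_top M⟩ (x j))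
        (blowupChart_le_preimage β i₀.ker ⟨⊤, isAffineOpen_top M⟩ (x j)) f =
      β.appLE ((⟨⊤, isAffineOpen_top M⟩ : M.affineOpens) : M.Opens) (blowupChart β i₀.ker ⟨⊤, isAffineOpen_top M⟩ (x j))
        (blowupChart_le_preimage β i₀.ker ⟨⊤, isAffineOpen_top M⟩ (x j)) (x j) ^ m * fj)
    (T' : Set M) (hT' : ∀ y ∈ T', y ∉ M.basicOpen f)
    {z : X'} (hz : z ∈ closure ((β : X' → M) ⁻¹' (T' \ (i₀.ker.support : Set M)))) : z ∉ X'.basicOpen fj := by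
  classical
  intro hzf
  set Wt : M.affineOpens := ⟨⊤, isAffineOpen_top M⟩ with hWt
  have hx : ∀ l, x l ∈ i₀.ker.ideal Wt := fun l => hgen ▸ Ideal.subset_span ⟨l, rfl⟩
  -- a point `w ∈ D(f_j)` over `T' ∖ V(ker i₀)`
  obtain ⟨w, hwO, hwT, hwsupp⟩ := mem_closure_iff.1 hz _ (X'.basicOpen fj).isOpen hzf
  have hwchart : w ∈ blowupChart β i₀.ker Wt (x j) := X'.basicOpen_le fj hwO
  -- some section of the centre ideal is invertible at `β w`
  have hnz : (β : X' → M) w ∉ M.zeroLocus (U := (Wt : M.Opens)) (i₀.ker.ideal Wt : Set Γ(M, Wt)) := by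
    intro h
    exact hwsupp ((Scheme.IdealSheafData.mem_support_iff_of_mem (I := i₀.ker) (U := Wt) (Opens.mem_top _)).2 h)
  rw [Scheme.mem_zeroLocus_iff] at hnz
  push Not at hnz
  obtain ⟨s, hs, hws⟩ := hnz
  -- on the chart, `β^*s = c · β^*x_j`
  obtain ⟨c, hc⟩ := (hβ.isPrincipalChart_blowupChart (U := Wt) (hx j)).exists_eq_mul hs
  have hw1 : w ∈ X'.basicOpen (β.appLE (Wt : M.Opens) (blowupChart β i₀.ker Wt (x j)) (blowupChart_le_preimage β i₀.ker Wt (x j)) s) := by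
    rw [Scheme.basicOpen_appLE]; exact ⟨hwchart, hws⟩
  have hc' : β.appLE (Wt : M.Opens) (blowupChart β i₀.ker Wt (x j)) (blowupChart_le_preimage β i₀.ker Wt (x j)) s =
      c * β.appLE (Wt : M.Opens) (blowupChart β i₀.ker Wt (x j)) (blowupChart_le_preimage β i₀.ker Wt (x j)) (x j) := hc
  rw [hc', Scheme.basicOpen_mul] at hw1
  -- hence `β^*f = (β^*x_j)^m f_j` is invertible at `w`, i.e. `β w ∈ D(f)`
  have hw2 : w ∈ X'.basicOpen (β.appLE (Wt : M.Opens) (blowupChart β i₀.ker Wt (x j)) (blowupChart_le_preimage β i₀.ker Wt (x j)) f) := by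
    rw [hfj, Scheme.basicOpen_mul, Scheme.basicOpen_pow _ _ hm]; exact ⟨hw1.2, hwO⟩
  rw [Scheme.basicOpen_appLE] at hw2
  exact hT' _ hwT hw2.2

/-- ★ **(T-C), AFFINE FORM — the strict transform meets the exceptional fibre inside the projectivised tangent cone.** `M` affine, `i₀ : B ↪ M`
a closed immersion with `(ker i₀)(M) = (x₀,…,xₙ)`, `x` quasi-regular, `β : X' → M` a blowing up along `ker i₀` (so `E = X' ×_M B ≅ ℙⁿ_{Γ(B)}`,
Literature ✓ `exists_iso_pullback_proj_charts`, Hartshorne II 8.24 (b)); `f ∈ Γ(M)` with `f ≡ P(x) mod (x)^{m+1}`, `P` a form of degree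
`m > 0` (an «initial form» of `f` along the centre, supplied by the user), and `T' ⊆ M` any set on which `f` vanishes. Then for the isomorphism
`φ : E ≅ ℙⁿ_{Γ(B)}` of loc. cit. — PINNED by its chart clauses (i)–(ii), which are conjoined to the conclusion verbatim (with the blow-up ratios `T`,
unique by `IsBlowup.chartRatio_unique`): `φ⁻¹ D₊(T_j) = E_j` and on `E_j` the ring map `ψ_j` with `ψ_j(T_l/T_j) = pr₁^*T_{jl}`, `ψ_j(i₀^*a) = pr₁^*β^*a` —
every point of `E` whose image in `X'` lies in the closure of `β⁻¹(T' ∖ V(ker i₀))` (the strict transform of `T'`) is mapped by `φ` into the zero locus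
`V₊(P̄)` of the reduced form `P̄ = P^{i₀^*} ∈ Γ(B)[T₀,…,Tₙ]`. SET-LEVEL `⊆` ONLY (no equality, no scheme structure on the strict transform is asserted);
`P̄ = 0` makes the conclusion vacuous. [OURS · L1 W4.5b · EL♮(3) · (T-C) tangent-cone door;
NOT a statement of the manuscript] [cite: Hartshorne1977, II Thm. 8.24 (b)] [cite: CossartPiltant2008, proof of Prop. 4.2, (10)–(11)] -/
theorem mem_zeroLocus_of_mem_closure_strictTransform (hβ : IsBlowup β i₀.ker) {n : ℕ} (x : Fin (n + 1) → Γ(M, ⊤))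
    (hgen : Ideal.span (Set.range x) = i₀.ker.ideal ⟨⊤, isAffineOpen_top M⟩) (hqr : IsQuasiRegular x)
    (f : Γ(M, ⊤)) {m : ℕ} (hm : 0 < m) (P : MvPolynomial (Fin (n + 1)) Γ(M, ⊤)) (hP : P.IsHomogeneous m)
    (hfP : f - MvPolynomial.eval x P ∈ Ideal.span (Set.range x) ^ (m + 1))
    (T' : Set M) (hT' : ∀ y ∈ T', y ∉ M.basicOpen f) :
    ∃ φ : pullback β i₀ ≅ Proj (grading (Fin (n + 1)) Γ(B, ⊤)),
      φ.hom ≫ toSpec (Fin (n + 1)) Γ(B, ⊤) = pullback.snd β i₀ ≫ B.toSpecΓ ∧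
      -- the chart clauses (i)–(ii) of `exists_iso_pullback_proj_charts`, verbatim: they PIN `φ` (the ratios `T` are unique, `IsBlowup.chartRatio_unique`)
      (∃ T : (j l : Fin (n + 1)) → Γ(X', blowupChart β i₀.ker ⟨⊤, isAffineOpen_top M⟩ (x j)),
        (∀ j l, β.appLE ((⟨⊤, isAffineOpen_top M⟩ : M.affineOpens) : M.Opens) (blowupChart β i₀.ker ⟨⊤, isAffineOpen_top M⟩ (x j))
            (blowupChart_le_preimage β i₀.ker ⟨⊤, isAffineOpen_top M⟩ (x j)) (x l) =
          β.appLE ((⟨⊤, isAffineOpen_top M⟩ : M.affineOpens) : M.Opens) (blowupChart β i₀.ker ⟨⊤, isAffineOpen_top M⟩ (x j))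
            (blowupChart_le_preimage β i₀.ker ⟨⊤, isAffineOpen_top M⟩ (x j)) (x j) * T j l) ∧
        ∀ j : Fin (n + 1),
          φ.hom ⁻¹ᵁ Proj.basicOpen (grading (Fin (n + 1)) Γ(B, ⊤)) (MvPolynomial.X j) =
              pullback.fst β i₀ ⁻¹ᵁ blowupChart β i₀.ker ⟨⊤, isAffineOpen_top M⟩ (x j) ∧
            ∃ ψ : Away (grading (Fin (n + 1)) Γ(B, ⊤)) (MvPolynomial.X j) →+*
                Γ(pullback β i₀, pullback.fst β i₀ ⁻¹ᵁ blowupChart β i₀.ker ⟨⊤, isAffineOpen_top M⟩ (x j)),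
              (pullback.fst β i₀ ⁻¹ᵁ blowupChart β i₀.ker ⟨⊤, isAffineOpen_top M⟩ (x j)).ι ≫ φ.hom =
                  (pullback.fst β i₀ ⁻¹ᵁ blowupChart β i₀.ker ⟨⊤, isAffineOpen_top M⟩ (x j)).toSpecΓ ≫
                    Spec.map (CommRingCat.ofHom ψ) ≫ chartι (Γ(B, ⊤) : Type u) j ∧
                (∀ l, ψ (frac (Γ(B, ⊤) : Type u) j l) =
                  (pullback.fst β i₀).app (blowupChart β i₀.ker ⟨⊤, isAffineOpen_top M⟩ (x j)) (T j l)) ∧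
                ∀ a : Γ(M, ⊤), ψ (cst (Γ(B, ⊤) : Type u) (MvPolynomial.X j) (i₀.appTop a)) =
                  (pullback.fst β i₀).app (blowupChart β i₀.ker ⟨⊤, isAffineOpen_top M⟩ (x j))
                    (β.appLE ((⟨⊤, isAffineOpen_top M⟩ : M.affineOpens) : M.Opens)
                      (blowupChart β i₀.ker ⟨⊤, isAffineOpen_top M⟩ (x j))
                      (blowupChart_le_preimage β i₀.ker ⟨⊤, isAffineOpen_top M⟩ (x j)) a)) ∧
      ∀ q : ↥(pullback β i₀), (pullback.fst β i₀ : _ → X') q ∈ closure ((β : X' → M) ⁻¹' (T' \ (i₀.ker.support : Set M))) →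
        (φ.hom : _ → Proj (grading (Fin (n + 1)) Γ(B, ⊤))) q ∈
          ProjectiveSpectrum.zeroLocus (grading (Fin (n + 1)) Γ(B, ⊤)) {MvPolynomial.map i₀.appTop.hom P} := by
  classical
  set Wt : M.affineOpens := ⟨⊤, isAffineOpen_top M⟩ with hWt
  have hx : ∀ l, x l ∈ i₀.ker.ideal Wt := fun l => hgen ▸ Ideal.subset_span ⟨l, rfl⟩
  -- the blow-up ratios and the coordinatised isomorphism `E ≅ ℙⁿ_{Γ(B)}`
  choose T hT using fun j l => hβ.exists_chartRatio Wt (u := x j) (v := x l) (hx j) (hx l)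
  obtain ⟨φ, hφ0, hφ⟩ := exists_iso_pullback_proj_charts hβ x hgen hqr T hT
  refine ⟨φ, hφ0, ⟨T, hT, hφ⟩, fun q hq => ?_⟩
  -- a chart `E_j ∋ q`
  obtain ⟨j, hqj⟩ : ∃ j, q ∈ pullback.fst β i₀ ⁻¹ᵁ blowupChart β i₀.ker Wt (x j) := by
    have h : q ∈ (⨆ k, pullback.fst β i₀ ⁻¹ᵁ blowupChart β i₀.ker Wt (x k)) := by
      rw [iSup_preimage_fst_blowupChart hβ Wt x hgen, Scheme.Hom.preimage_top, Scheme.Hom.preimage_top]; trivial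
    exact Opens.mem_iSup.1 h
  obtain ⟨-, ψ, hψι, hψT, hψc⟩ := hφ j
  -- the strict transform `f_j` of `f` on the chart `X'[⊤, x_j]`
  obtain ⟨r, hr⟩ := exists_chart_factorisation
    (β.appLE (Wt : M.Opens) (blowupChart β i₀.ker Wt (x j)) (blowupChart_le_preimage β i₀.ker Wt (x j))).hom x j (T j) (hT j) hP hfP
  set fj := eval₂ (β.appLE (Wt : M.Opens) (blowupChart β i₀.ker Wt (x j)) (blowupChart_le_preimage β i₀.ker Wt (x j))).hom (T j) P +
    β.appLE (Wt : M.Opens) (blowupChart β i₀.ker Wt (x j)) (blowupChart_le_preimage β i₀.ker Wt (x j)) (x j) * r with hfj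
  have hz : (pullback.fst β i₀ : _ → X') q ∉ X'.basicOpen fj :=
    not_mem_basicOpen_of_mem_closure hβ x hgen j f hm fj hr T' hT' hq
  -- its restriction to `E_j` is `ψ (P̄ / T_j^m)`
  have hPbar : MvPolynomial.map i₀.appTop.hom P ∈ grading (Fin (n + 1)) Γ(B, ⊤) m := by simpa using hP.map i₀.appTop.hom
  have hsec : (pullback.fst β i₀).app (blowupChart β i₀.ker Wt (x j)) fj =
      ψ (Away.isLocalizationElem (X_mem (Γ(B, ⊤) : Type u) j) hPbar) := by
    rw [chartMap_isLocalizationElem_eq x j (T j) ψ hψT hψc hP, hfj, map_add, map_mul,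
      fst_app_appLE_eq_zero _ _ (hx j), zero_mul, add_zero]
  -- suppose `P̄ ∉ 𝔭_{φ q}`, i.e. `φ q ∈ D₊(P̄)`; read this on the chart `E_j → D₊(T_j)`
  rw [ProjectiveSpectrum.mem_zeroLocus, Set.singleton_subset_iff, SetLike.mem_coe]
  by_contra hnot
  have hmem : (φ.hom : _ → Proj (grading (Fin (n + 1)) Γ(B, ⊤))) q ∈ Proj.basicOpen (grading (Fin (n + 1)) Γ(B, ⊤))
      (MvPolynomial.map i₀.appTop.hom P) := (Proj.mem_basicOpen _ _ _).2 hnot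
  have e1 : (φ.hom : _ → Proj (grading (Fin (n + 1)) Γ(B, ⊤))) q =
      ((pullback.fst β i₀ ⁻¹ᵁ blowupChart β i₀.ker Wt (x j)).ι ≫ φ.hom :
        _ → Proj (grading (Fin (n + 1)) Γ(B, ⊤))) ⟨q, hqj⟩ := by
    rw [Scheme.Hom.comp_apply]; rfl
  rw [e1, hψι, Scheme.Hom.comp_apply, Scheme.Hom.comp_apply] at hmem
  have hmem2 : (Spec.map (CommRingCat.ofHom ψ) : _ → _) ((pullback.fst β i₀ ⁻¹ᵁ blowupChart β i₀.ker Wt (x j)).toSpecΓ ⟨q, hqj⟩) ∈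
      chartι (Γ(B, ⊤) : Type u) j ⁻¹ᵁ Proj.basicOpen (grading (Fin (n + 1)) Γ(B, ⊤)) (MvPolynomial.map i₀.appTop.hom P) := hmem
  rw [Proj.awayι_preimage_basicOpen _ (X_mem (Γ(B, ⊤) : Type u) j) zero_lt_one hPbar hm] at hmem2
  have hmem3 : (pullback.fst β i₀ ⁻¹ᵁ blowupChart β i₀.ker Wt (x j)).toSpecΓ ⟨q, hqj⟩ ∈
      PrimeSpectrum.basicOpen (ψ (Away.isLocalizationElem (X_mem (Γ(B, ⊤) : Type u) j) hPbar)) := by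
    rw [PrimeSpectrum.mem_basicOpen] at hmem2 ⊢
    exact hmem2
  have hmem4 : (⟨q, hqj⟩ : ↥(pullback.fst β i₀ ⁻¹ᵁ blowupChart β i₀.ker Wt (x j))) ∈
      (pullback.fst β i₀ ⁻¹ᵁ blowupChart β i₀.ker Wt (x j)).toSpecΓ ⁻¹ᵁ
        PrimeSpectrum.basicOpen (ψ (Away.isLocalizationElem (X_mem (Γ(B, ⊤) : Type u) j) hPbar)) := hmem3
  rw [Scheme.Opens.toSpecΓ_preimage_basicOpen, ← hsec, ← Scheme.preimage_basicOpen] at hmem4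
  exact hz hmem4

end Fibre



end TangentCone

end Summit.ResolutionOfSingularities.ResolutionOfSingularities.Cruxes.EquisingularLiftNat.Sections

end
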